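import Summits.KontsevichZagierPeriods.KontsevichZagierPeriods.Theses.OctahedralSymmetry
import Literature.NumberTheory.Transcendental.BoxCoordinatePowerMap
import Literature.NumberTheory.Transcendental.MZVSimplexRep
import Summits.KontsevichZagierPeriods.KontsevichZagierPeriods.Theorems.HurwitzMicroSectorsDilationMoveStubIsSemialgebraicMapOnCoordPow
import Summits.KontsevichZagierPeriods.KontsevichZagierPeriods.Theorems.HurwitzMicroSectorsDilationMoveStubOrthantCoordPowMove

/-!
# `SimplexDilationMove` (stmt-KontsevichZagierPeriods-9436, route `OctahedralSymmetry`, support #9)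

Distribution is ONE dilation: for representations `r, r'` of the Kontsevich–Zagier calculus on
the open ordered simplex `Δ_w = {t | (∀ i, 0 < tᵢ) ∧ (∀ i, tᵢ < 1) ∧ StrictAnti t}` with
`r.integrand t = r'.integrand (tⱼ²)ⱼ · ∏ⱼ 2tⱼ` on `Δ_w`, the difference `[r] − [r']` is one
change-of-variables generator (`KZ.changeOfVariablesRel`, rule (2) of [Kontsevich–Zagier 2001,
§1.2]).

Proof. The witness is the coordinatewise power map `Φ₂ = BoxIntegral.coordPow 2`
(`x ↦ (xᵢ²)ᵢ`) with derivative `Φ₂' = BoxIntegral.coordPowDeriv 2` (`diag(2xᵢ)`). The simplex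
lies in the open orthant, so the orthant dilation move of route `HurwitzMicroSectors`
(`HurwitzMicroSectors.DilationMove.stub_orthantCoordPowMove`: injectivity, derivative, positive
Jacobian `2ʷ ∏ xᵢ = ∏ 2xᵢ`; tameness by `stub_isSemialgebraicMapOn_coordPow`) applies on the
domain `Δ_w`; the one new ingredient is that the TARGET domain is the simplex again:
`Φₘ '' Δ_w = Δ_w` for every `m ≥ 1` (`image_coordPow_openOrderedSimplex`), because `t ↦ tᵐ` is a
strictly increasing bijection of `(0,1)` (inverse `y ↦ y^{1/m}`), hence preserves `0 < · < 1`
and strict decrease of the coordinates in both directions.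

## References

* M. Kontsevich, D. Zagier, *Periods* (2001), §1.2, rule (2).
* J. Zhao, *Standard relations of multiple polylogarithm values at roots of unity*,
  arXiv:0707.1459 (distribution relations).
-/

noncomputable section

open Set MeasureTheory
open Literature.NumberTheory.Transcendental
open Literature.ModelTheory.ExponentialFields (IsSemialgebraic)

namespace Summit.KontsevichZagierPeriods.OctahedralSymmetry.SimplexDilationMove

open Summit.KontsevichZagierPeriods.KontsevichZagierPeriods.Theses.OctahedralSymmetry
  (SimplexDilationMove)
open Summit.KontsevichZagierPeriods.HurwitzMicroSectors.DilationMove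
  (stub_orthantCoordPowMove stub_isSemialgebraicMapOn_coordPow)

variable {n : ℕ}

/-- `Φₘ` maps the open ordered simplex `Δ_n = {1 > t₀ > ⋯ > t_{n-1} > 0}` into itself (`m ≥ 1`):
`t ↦ tᵐ` preserves `(0,1)` and is strictly increasing on `[0,∞)`. [folklore] -/
theorem mapsTo_coordPow_openOrderedSimplex {m : ℕ} (hm : m ≠ 0) :
    MapsTo (BoxIntegral.coordPow (n := n) m) (KZ.openOrderedSimplex n)
      (KZ.openOrderedSimplex n) := by
  rintro t ⟨h0, h1, hanti⟩
  refine ⟨fun i => pow_pos (h0 i) m, fun i => pow_lt_one₀ (h0 i).le (h1 i) hm, ?_⟩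
  intro i j hij
  simp only [BoxIntegral.coordPow_apply]
  exact pow_lt_pow_left₀ (hanti hij) (h0 j).le hm

/-- **`Φₘ '' Δ_n = Δ_n` exactly** (`m ≥ 1`) for the open ordered simplex
`Δ_n = {1 > t₀ > ⋯ > t_{n-1} > 0}`: every `y ∈ Δ_n` is `Φₘ(x)` with `xᵢ = yᵢ^{1/m}`, and
`y ↦ y^{1/m}` is strictly increasing on `[0,∞)` and preserves `(0,1)`, so `x ∈ Δ_n`.
(Simplex analogue of `BoxIntegral.image_coordPow_box`.) [folklore] -/
theorem image_coordPow_openOrderedSimplex {m : ℕ} (hm : m ≠ 0) :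
    BoxIntegral.coordPow (n := n) m '' KZ.openOrderedSimplex n = KZ.openOrderedSimplex n := by
  refine (mapsTo_coordPow_openOrderedSimplex hm).image_subset.antisymm fun y hy => ?_
  obtain ⟨h0, h1, hanti⟩ := hy
  have hmpos : (0 : ℝ) < (m : ℝ)⁻¹ := by positivity
  refine ⟨fun i => y i ^ ((m : ℝ)⁻¹), ⟨fun i => ?_, fun i => ?_, ?_⟩, ?_⟩
  · exact Real.rpow_pos_of_pos (h0 i) _
  · exact Real.rpow_lt_one (h0 i).le (h1 i) hmpos
  · intro i j hij
    exact Real.rpow_lt_rpow (h0 j).le (hanti hij) hmpos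
  · funext i
    simp only [BoxIntegral.coordPow_apply]
    exact Real.rpow_inv_natCast_pow (h0 i).le hm

/-- The Jacobian factor of the squaring map in the literal shape of the route item:
`∏ⱼ 2xⱼ = 2ⁿ ∏ⱼ xⱼ^(2-1)`. [folklore] -/
theorem prod_two_mul_eq (x : Fin n → ℝ) :
    ∏ j, (2 * x j) = (2 : ℝ) ^ n * ∏ i, x i ^ (2 - 1) := by
  rw [Finset.prod_mul_distrib, Finset.prod_const, Finset.card_univ, Fintype.card_fin]
  simp

/-- **The simplex dilation move** (route item `OctahedralSymmetry.SimplexDilationMove`,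
stmt-KontsevichZagierPeriods-9436). For every `w` and representations `r, r'` on the open ordered
simplex `Δ_w` with `r.integrand t = r'.integrand (tⱼ²)ⱼ · ∏ⱼ 2tⱼ` on `Δ_w`, `[r] − [r']` is ONE
change-of-variables generator of the Kontsevich–Zagier calculus: witness `Φ = (xⱼ²)ⱼ`,
`Φ' = diag(2xⱼ)`, `|det Φ'| = ∏ 2xⱼ > 0` on `Δ_w ⊆ (0,∞)ʷ`, `Φ '' Δ_w = Δ_w`
(`image_coordPow_openOrderedSimplex`); packaged through the orthant move
`HurwitzMicroSectors.DilationMove.stub_orthantCoordPowMove` with `m = 2`. It realises the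
level-2 → level-4 distribution relations `d(t²)/(t² − b) = dt/(t − √b) + dt/(t + √b)` as single
moves. [Kontsevich–Zagier 2001, §1.2, rule (2)] -/
theorem simplexDilationMove_proof : SimplexDilationMove := by
  unfold SimplexDilationMove
  intro w r r' hr hr' hint
  have hsub : r.domain ⊆ {x | ∀ i, 0 < x i} := by
    rw [hr]
    exact fun x hx => hx.1
  refine stub_orthantCoordPowMove w 2 (by norm_num) r r' hsub
    (stub_isSemialgebraicMapOn_coordPow w 2 r.domain r.isSemialgebraic_domain) ?_ ?_
  · rw [hr', hr]
    exact (image_coordPow_openOrderedSimplex (n := w) two_ne_zero).symm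
  · intro x hx
    rw [hint x hx, prod_two_mul_eq]
    rfl

end Summit.KontsevichZagierPeriods.OctahedralSymmetry.SimplexDilationMove

end
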